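import Mathlib
import Summits.Ventures.HodgeRepro2.Tier7.Line3.ArchimedeanCover
import Summits.Ventures.HodgeRepro2.Tier7.Line3.ArchimedeanDiscrete

/-!
# Tier 7 — LINE 3 support: THE ARCHIMEDEAN CONSUMER WITH NO GROUP-SIDE HYPOTHESIS LEFT — the inclusion
`U(2) × U(1,1)² ↪ ∏_{w|∞} GL₂(ℂ)` for a labelling of the three complex places, the lattice it cuts out of an integral
subgroup of `GL₂(E)`, and the continuity of its Poincaré series (`Line3/ArchimedeanLattice.lean`; t7-L1-p1, gen 6;
Mathlib + Line3/ArchimedeanCover + Line3/ArchimedeanDiscrete)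

ArchimedeanCover (`continuous_kernelSum_H₃`) made the named cover a theorem and left ONE group-side binder, `IsolatedOne Γ`
for `Γ ≤ H₃ = U(2) × U(1,1)²`; ArchimedeanDiscrete made `1` isolated in the archimedean image of any subgroup of `GL₂(E)`
integral in a basis `P` — in `∏_{w complex} GL₂(ℂ)`. THIS FILE is the glue:
* §1 for a LABELLING `e : Fin 3 ≃ {w // w.IsComplex}` of the complex places of `E` — the DISPLAYED datum «`E` has exactly
  three complex places» ([E′⁺ : ℚ] = 3 for the real `E′`; not vacuous: `E = ℚ(ζ₇)`, degree 6, totally complex, three complex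
  places) — the inclusion `incl E e : H₃ →* ((w : {w // w.IsComplex}) → GL (Fin 2) ℂ)`, `(k, u, u′) ↦ (w ↦ ![k, u, u′] (e.symm w))`
  (`U(2) → GL₂(ℂ)` by Mathlib's `Unitary.toUnits`, `U(1,1) → GL₂(ℂ)` by the subgroup inclusion): a homomorphism, CONTINUOUS
  (`continuous_incl`: coordinate by coordinate into the Pi type; `Unitary.toUnits` is continuous by `Units.continuous_iff`, its
  inverse value being `star`) and INJECTIVE (`injective_incl`: read the three components back at `e 0`, `e 1`, `e 2`); its
  kernel is `⊥`, a finite set (`finite_ker_incl`). With a labelling, no place is left over: a version with an «else 1»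
  default for unlabelled places would make the lattice below trivial as soon as a fourth complex place existed
  (crit-2 l. 16193 (i), plan-3 l. 16195 (1)) — the labelling is the datum that excludes it.
* §2 `latticeIn E Γ e := (Γ.map (archEmb E)).comap (incl E e) ≤ H₃` — the elements `(k, u, u′)` of `U(2) × U(1,1)²` whose
  three components are the `e 0, e 1, e 2`-images of ONE `g ∈ Γ ≤ GL (Fin 2) E` in the STANDARD coordinates of `GL₂(E)`
  (`mem_latticeIn`) — and **`isolatedOne_latticeIn`**: `1` is isolated in it whenever `Γ` is integral in a basis `P`
  (DiscreteCoverLift's `isolatedOne_comap_of_finite_ker` along the continuous `incl` with finite kernel + ArchimedeanDiscrete's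
  `isolatedOne_map_of_integral_conj`);
* §3 THE CONSUMER **`continuous_kernelSum_latticeIn`** = ArchimedeanCover's `continuous_kernelSum_H₃` at `Γ := latticeIn E Γ e`,
  by `exact`, every other binder VERBATIM (`f`, `hfc`, `f₁ f₂ f₃`, `hc₁`, `hfp`, `C₂ C₃ α`, `hα`, `h₂`, `h₃`) and the
  `IsolatedOne` binder DISCHARGED: the Poincaré series of `latticeIn E Γ e` for any continuous `f : H₃ → ℂ` whose pull-back
  through `cover` factors as `f₁ ⊗ f₂ ⊗ f₃` with the `(1 + κ)^(−α)` decay, `α > 1`, is continuous on `H₃ × H₃`. REMAINING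
  BINDERS: `htc` (`E` totally complex), `Γ`, `P`, `hΓ` (`P⁻¹ γ P` integral for `γ ∈ Γ`), the labelling `e`, and the
  test-function clauses — every one a DATUM sentence; NO hypothesis on the group, the cover, its kernel, or the discreteness
  of the lattice remains.

TOPOLOGIES: `H₃` exactly as in ArchimedeanCover (the product of the subtype topologies of `M₂(ℂ)` on `U(2)` and of the units
topology on `GL (Fin 2) ℂ` on `U(1,1)`) — the consumer is ArchimedeanCover's theorem applied, no transport; the target
`∏_w GL₂(ℂ)` exactly as in ArchimedeanDiscrete (`Pi.topologicalSpace` of the units topology). WHAT STAYS IN WORDS (the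
dictionary, (a′)): that the real `Γ_N` IS `latticeIn E′ (U(W_A)(F) ∩ level) e` for the labelling `e = (ι₁, ι₂, ι₃)` of the
three complex places of `E′` — which includes the PER-PLACE CHANGE OF BASIS diagonalising `ι_v(W_A)` to `diag(1, 1)` at `ι₁`
and `diag(1, −1)` at `ι₂, ι₃` (form, basis, signature pattern `(2,0), (1,1), (1,1)`, level), i.e. that the unitarity
conditions at the three places, read through THIS inclusion after that change of basis, cut out the real lattice — and which
`f` is the real test function. Not vacuous: `latticeIn E (integralGL E) e` contains `(−1, −1, −1)` (the image of `−1`). Nothing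
about (N), (P), the real X or HC_CM; [M]-level consolidation of the [W] column; NOT distance to (P); the residual (a′)/(b′)
is unchanged in kind; LEMMAS CLOSING THE STEP: 0. Sorry-free; axioms: propext / Classical.choice / Quot.sound.
§8(d): uses an L-value-free non-vanishing device: NO.
-/

namespace Summit.Ventures.HodgeRepro2.Tier7.Line3.ArchimedeanLattice

open NumberField Topology
open Summit.Ventures.HodgeRepro2.Tier7.Line3.DiscreteCoverLift (IsolatedOne isolatedOne_comap_of_finite_ker)
open Summit.Ventures.HodgeRepro2.Tier7.Line3.ArchimedeanCover (U11 H₃ cover continuous_kernelSum_H₃)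
open Summit.Ventures.HodgeRepro2.Tier7.Line3.ArchimedeanDiscrete
  (IntegralEntries archEmb isolatedOne_map_of_integral_conj integralGL)
open Summit.Ventures.HodgeRepro2.Tier7.Line3.DiscreteUnitaryFactor (U2 K₃)
open Summit.Ventures.HodgeRepro2.Tier7.Line3.DiscreteProductCount (G₂)
open Summit.Ventures.HodgeRepro2.Tier7.Line3.HyperbolicSize (κ)
open Summit.Ventures.HodgeRepro2.Tier7.Line3.PoincareKernel (kernelSum)
open scoped MatrixGroups

noncomputable section

variable (E : Type) [Field E] [NumberField E]

/-! ## 1. The inclusion `U(2) × U(1,1)² ↪ ∏_{w complex} GL₂(ℂ)` for a labelling of three distinct complex places -/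

/-- `U(2) ⊂ GL₂(ℂ)`: Mathlib's `Unitary.toUnits` on `Matrix.unitaryGroup (Fin 2) ℂ` is continuous (`Units.continuous_iff`:
the value is the matrix, the inverse value its adjoint `star`). -/
theorem continuous_toUnits_U2 : Continuous (Unitary.toUnits : U2 → GL (Fin 2) ℂ) := by
  rw [Units.continuous_iff]
  refine ⟨continuous_subtype_val, ?_⟩
  have h : (fun x : U2 => (((Unitary.toUnits x : GL (Fin 2) ℂ)⁻¹ : GL (Fin 2) ℂ) : Matrix (Fin 2) (Fin 2) ℂ)) =
      fun x : U2 => star (x : Matrix (Fin 2) (Fin 2) ℂ) := by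
    funext x
    rfl
  rw [h]
  exact continuous_star.comp continuous_subtype_val

omit [NumberField E] in
/-- **the inclusion** for a LABELLING `e : Fin 3 ≃ {w // w.IsComplex}` of the complex places (the datum «`E` has exactly
three complex places», e.g. `E = ℚ(ζ₇)`): `(k, u, u′) ↦ (w ↦ ![k, u, u′] (e.symm w))` — the `U(2)`-component at `e 0`, the
two `U(1,1)`-components at `e 1`, `e 2`; no place is left over, so nothing is sent to `1` by default. -/
def incl (e : Fin 3 ≃ {w : InfinitePlace E // w.IsComplex}) :
    H₃ →* ((w : {w : InfinitePlace E // w.IsComplex}) → GL (Fin 2) ℂ) where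
  toFun h := fun w => ![Unitary.toUnits h.1, (h.2.1 : GL (Fin 2) ℂ), (h.2.2 : GL (Fin 2) ℂ)] (e.symm w)
  map_one' := by
    funext w
    show ![Unitary.toUnits (1 : H₃).1, ((1 : H₃).2.1 : GL (Fin 2) ℂ), ((1 : H₃).2.2 : GL (Fin 2) ℂ)] (e.symm w) =
      (1 : (w : {w : InfinitePlace E // w.IsComplex}) → GL (Fin 2) ℂ) w
    generalize e.symm w = i
    fin_cases i <;> simp
  map_mul' a b := by
    funext w
    show ![Unitary.toUnits (a * b).1, ((a * b).2.1 : GL (Fin 2) ℂ), ((a * b).2.2 : GL (Fin 2) ℂ)] (e.symm w) =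
      ![Unitary.toUnits a.1, (a.2.1 : GL (Fin 2) ℂ), (a.2.2 : GL (Fin 2) ℂ)] (e.symm w) *
        ![Unitary.toUnits b.1, (b.2.1 : GL (Fin 2) ℂ), (b.2.2 : GL (Fin 2) ℂ)] (e.symm w)
    generalize e.symm w = i
    fin_cases i <;> simp

omit [NumberField E] in
/-- the `e 0`-coordinate of `incl` is the `U(2)`-component -/
theorem incl_apply_zero (e : Fin 3 ≃ {w : InfinitePlace E // w.IsComplex}) (h : H₃) :
    incl E e h (e 0) = Unitary.toUnits h.1 := by
  simp [incl]

omit [NumberField E] in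
/-- the `e 1`-coordinate of `incl` is the first `U(1,1)`-component -/
theorem incl_apply_one (e : Fin 3 ≃ {w : InfinitePlace E // w.IsComplex}) (h : H₃) :
    incl E e h (e 1) = (h.2.1 : GL (Fin 2) ℂ) := by
  simp [incl]

omit [NumberField E] in
/-- the `e 2`-coordinate of `incl` is the second `U(1,1)`-component -/
theorem incl_apply_two (e : Fin 3 ≃ {w : InfinitePlace E // w.IsComplex}) (h : H₃) :
    incl E e h (e 2) = (h.2.2 : GL (Fin 2) ℂ) := by
  simp [incl]

omit [NumberField E] in
/-- **`incl` is continuous** (coordinate by coordinate into the Pi type; each coordinate is one of the three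
component maps). -/
theorem continuous_incl (e : Fin 3 ≃ {w : InfinitePlace E // w.IsComplex}) : Continuous (incl E e) := by
  refine continuous_pi fun w => ?_
  show Continuous fun h : H₃ =>
    ![Unitary.toUnits h.1, (h.2.1 : GL (Fin 2) ℂ), (h.2.2 : GL (Fin 2) ℂ)] (e.symm w)
  generalize e.symm w = i
  fin_cases i
  · exact continuous_toUnits_U2.comp continuous_fst
  · exact continuous_subtype_val.comp (continuous_fst.comp continuous_snd)
  · exact continuous_subtype_val.comp (continuous_snd.comp continuous_snd)

omit [NumberField E] in
/-- **`incl` is injective** (read the three components back at `e 0`, `e 1`, `e 2`). -/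
theorem injective_incl (e : Fin 3 ≃ {w : InfinitePlace E // w.IsComplex}) : Function.Injective (incl E e) := by
  intro a b hab
  have e0 := congrFun hab (e 0)
  have e1 := congrFun hab (e 1)
  have e2 := congrFun hab (e 2)
  rw [incl_apply_zero, incl_apply_zero] at e0
  rw [incl_apply_one, incl_apply_one] at e1
  rw [incl_apply_two, incl_apply_two] at e2
  exact Prod.ext (Unitary.toUnits_injective e0) (Prod.ext (Subtype.ext e1) (Subtype.ext e2))

omit [NumberField E] in
/-- the kernel of `incl` is trivial, a finite set -/
theorem finite_ker_incl (e : Fin 3 ≃ {w : InfinitePlace E // w.IsComplex}) :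
    ((incl E e).ker : Set H₃).Finite := by
  rw [(MonoidHom.ker_eq_bot_iff _).2 (injective_incl E e), Subgroup.coe_bot]
  exact Set.finite_singleton _

/-! ## 2. The lattice cut out of `Γ ≤ GL₂(E)` inside `U(2) × U(1,1)²`, and its isolation -/

omit [NumberField E] in
/-- **the lattice in `H₃`**: the elements of `U(2) × U(1,1)²` that are the archimedean images of elements of `Γ` -/
def latticeIn (Γ : Subgroup (GL (Fin 2) E)) (e : Fin 3 ≃ {w : InfinitePlace E // w.IsComplex}) : Subgroup H₃ :=
  (Γ.map (archEmb E)).comap (incl E e)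

omit [NumberField E] in
/-- membership in `latticeIn`: `h ∈ latticeIn E Γ e ↔ ∃ g ∈ Γ, archEmb E g = incl E e h` -/
theorem mem_latticeIn (Γ : Subgroup (GL (Fin 2) E)) (e : Fin 3 ≃ {w : InfinitePlace E // w.IsComplex}) (h : H₃) :
    h ∈ latticeIn E Γ e ↔ ∃ g ∈ Γ, archEmb E g = incl E e h := Iff.rfl

/-- **`1` is isolated in the lattice cut out of an integral subgroup** (`E` totally complex; `Γ` integral in the basis `P`;
a labelling `e` of the three complex places). -/
theorem isolatedOne_latticeIn (htc : ∀ w : InfinitePlace E, w.IsComplex) (Γ : Subgroup (GL (Fin 2) E))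
    (P : GL (Fin 2) E) (hΓ : ∀ g ∈ Γ, IntegralEntries E ((P⁻¹ * g * P : GL (Fin 2) E) : Matrix (Fin 2) (Fin 2) E))
    (e : Fin 3 ≃ {w : InfinitePlace E // w.IsComplex}) : IsolatedOne (latticeIn E Γ e) :=
  isolatedOne_comap_of_finite_ker (incl E e) (continuous_incl E e) (finite_ker_incl E e)
    (isolatedOne_map_of_integral_conj E htc Γ P hΓ)

/-! ## 3. THE CONSUMER: the Poincaré series of the lattice is continuous — no group-side hypothesis left -/

/-- **THE REAL ARCHIMEDEAN KERNEL IS CONTINUOUS FOR THE LATTICE CUT OUT OF AN INTEGRAL SUBGROUP**: ArchimedeanCover's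
`continuous_kernelSum_H₃` at `Γ := latticeIn E Γ w₁ w₂ w₃` with its `IsolatedOne` binder discharged by
`isolatedOne_latticeIn`. Remaining binders: `htc`, `Γ`, `P`, `hΓ`, the three distinct places, and the test-function
clauses — every one a datum sentence; which `Γ_N` and which `f` are the real ones is the dictionary (a′). -/
theorem continuous_kernelSum_latticeIn (htc : ∀ w : InfinitePlace E, w.IsComplex) (Γ : Subgroup (GL (Fin 2) E))
    (P : GL (Fin 2) E) (hΓ : ∀ g ∈ Γ, IntegralEntries E ((P⁻¹ * g * P : GL (Fin 2) E) : Matrix (Fin 2) (Fin 2) E))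
    (e : Fin 3 ≃ {w : InfinitePlace E // w.IsComplex}) (f : H₃ → ℂ) (hfc : Continuous f) {f₁ : K₃ → ℂ} {f₂ f₃ : SL(2, ℝ) → ℂ} (hc₁ : Continuous f₁)
    (hfp : ∀ g : K₃ × G₂, f (cover g) = f₁ g.1 * (f₂ g.2.1 * f₃ g.2.2)) {C₂ C₃ α : ℝ} (hα : 1 < α)
    (h₂ : ∀ g, ‖f₂ g‖ ≤ C₂ * (1 + κ g) ^ (-α)) (h₃ : ∀ g, ‖f₃ g‖ ≤ C₃ * (1 + κ g) ^ (-α)) :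
    Continuous (fun q : H₃ × H₃ =>
      kernelSum (fun γ : latticeIn E Γ e => (γ : H₃)) f q.1 q.2) :=
  continuous_kernelSum_H₃ (isolatedOne_latticeIn E htc Γ P hΓ e) f hfc hc₁ hfp hα h₂ h₃

end

end Summit.Ventures.HodgeRepro2.Tier7.Line3.ArchimedeanLattice
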